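import Literature.NumberTheory.EllipticCurves.FormalMulThreeHeightDichotomyProofs
import HarnessLib

/-! # Finite height with `J ≤ 9` in characteristic `3` — stub `stub_finiteHeightThree` of line
# `Sketch`, crux `MazurKenkuBound` (stmt-ABC-15125)

WHAT. Over a field `k` of characteristic `3`, a Weierstrass equation `E` with `Δ(E) ≠ 0` (the
registered stub also carries the normal-form hypotheses `a₁ = a₃ = a₆ = 0` of the model
`y² = x³ + a₂x² + a₄x`, which are not needed) has a NONZERO coefficient of the formal
multiplication-by-`3` series `[3](z) = E.formalMul 3` in some degree `0 < J ≤ 9`; in fact `J = 3`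
or `J = 9` ("height `1` or `2`", Silverman *AEC* IV.7.5, made explicit at `p = 3`).

PROOF. This is the tree's height dichotomy
`WeierstrassCurve.isUnit_coeff_formalMul_three_or`
(`Literature.NumberTheory.EllipticCurves.FormalMulThreeHeightDichotomyProofs`): either
`[z³][3] = b₂` (the Hasse invariant at `3`, by the Katz–Mazur congruence
`exists_formalMul_prime_eq_X_pow_mul`) is a unit — take `J = 3` — or `b₂ = 0`, and then the
division-polynomial identity `sum_ΨSq_mul_formalXMulSq_subst_formalMul 3` with `ΨSq₃ = b₈²`
constant and `Φ₃ = X⁹` forces `[3]` to have order exactly `9` with `([z⁹][3])² = b₈² ≠ 0` — take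
`J = 9`.
-/

-- `Summit.<Summit>.<Problem>` is the mandated summit-side namespace (CONVENTIONS §2); for the
-- single-conjunct summit `ABC` the two coincide, so the duplicate `ABC.ABC` is deliberate.
set_option linter.dupNamespace false

noncomputable section

open PowerSeries WeierstrassCurve

namespace Summit.ABC.ABC.Theorems

/-- **A nonzero coefficient of `[3]` in degree `3` or `9` in characteristic `3`.** For a
Weierstrass equation `E` over a field of characteristic `3` with `Δ(E) ≠ 0`, either
`[z³][3](z) ≠ 0` (ordinary: the Hasse invariant `b₂ ≠ 0`) or `[z⁹][3](z) ≠ 0` (supersingular: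
`b₂ = 0`, `([z⁹][3])² = b₈² ≠ 0`) — the tree's `WeierstrassCurve.isUnit_coeff_formalMul_three_or`.
[cite: SilvermanAEC2009, IV.7.5 and V.3.1] -/
theorem coeff_three_formalMul_three_ne_zero_or {k : Type*} [Field k] [CharP k 3]
    (E : WeierstrassCurve k) (hΔ : E.Δ ≠ 0) :
    coeff 3 (E.formalMul 3) ≠ 0 ∨ coeff 9 (E.formalMul 3) ≠ 0 := by
  rcases E.isUnit_coeff_formalMul_three_or hΔ with h3 | ⟨-, h9⟩
  · exact Or.inl h3.ne_zero
  · exact Or.inr h9.ne_zero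

/-- **Finite height of `y² = x³ + a₂x² + a₄x` in characteristic `3`, with the first nonzero
coefficient of `[3]` in degree `≤ 9`.** Over a field of characteristic `3`, a Weierstrass equation
with `a₁ = a₃ = a₆ = 0` and `Δ ≠ 0` has `coeff J [3] ≠ 0` for some `0 < J ≤ 9`: if the Hasse
invariant `hasseCoeff 3 = b₂` is nonzero, `J = 3` (`exists_formalMul_prime_eq_X_pow_mul`); otherwise
`b₂ = 0`, `ΨSq 3 = Ψ₃² = b₈²` is a nonzero CONSTANT and `Φ 3 = X⁹`, so the division-polynomial
identity `sum_ΨSq_mul_formalXMulSq_subst_formalMul 3` reads `b₈² z¹⁸ u([3]z) = u(z)⁹ [3](z)²`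
(`u = formalXMulSq = 1 + ⋯`), whence `[3] ≠ 0` has order exactly `9` and `J = 9` (the tree's
`WeierstrassCurve.isUnit_coeff_formalMul_three_or`; the hypotheses `a₁ = a₃ = a₆ = 0` are not
used). [cite: SilvermanAEC2009, IV.4.4, IV.7.5, Ex. 3.7 and V.3.1] -/
theorem stub_finiteHeightThree :
    ∀ {k : Type*} [Field k] [CharP k 3] (E : WeierstrassCurve k),
      E.a₁ = 0 → E.a₃ = 0 → E.a₆ = 0 → E.Δ ≠ 0 →
      ∃ J : ℕ, 0 < J ∧ J ≤ 9 ∧ coeff J (E.formalMul 3) ≠ 0 := by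
  intro k _ _ E _ _ _ hΔ
  rcases coeff_three_formalMul_three_ne_zero_or E hΔ with h3 | h9
  · exact ⟨3, by norm_num, by norm_num, h3⟩
  · exact ⟨9, by norm_num, le_rfl, h9⟩

end Summit.ABC.ABC.Theorems
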